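import Literature.AlgebraicTopology.SingularHomology.MayerVietorisFiniteness
import Literature.AlgebraicTopology.SingularHomology.EulerCharacteristicTriple
import Literature.AlgebraicTopology.SingularHomology.ExcisionTheorem
import Mathlib.LinearAlgebra.Dimension.Localization
import Mathlib.RingTheory.Finiteness.Prod
import HarnessLib

/-!
# The Euler characteristic along the Mayer–Vietoris sequence: `χ(U ∪ V) + χ(U ∩ V) = χ(U) + χ(V)`

A. Hatcher, *Algebraic Topology* (2002), §2.2: the Mayer–Vietoris sequence (pp. 149–150) of an
open cover `X = U ∪ V` is a long exact sequence
`⋯ → Hₙ(U ∩ V) → Hₙ(U) ⊕ Hₙ(V) → Hₙ(X) → Hₙ₋₁(U ∩ V) → ⋯ → H₀(X) → 0`, and the Euler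
characteristic is additive along long exact sequences of finitely generated modules (proof of
Thm. 2.44; Ex. 2.2.20–2.2.21: `χ(X) = χ(A) + χ(B) - χ(A ∩ B)`; Spanier 1966, Ch. 4 §3 Thm. 14 and
§6 Ex. B).  This file packages the tree's Mayer–Vietoris sequence (`mayerVietoris.φ/ψ/δ`,
`exact₁/₂/₃_holds`, `ψ_surjective_zero`, excision `isIso_map_of_interior_union_interior_holds`)
as a `GradedLES` (`EulerCharacteristicTriple.lean`) and reads off, for coefficients in a finitely
generated module over a Noetherian domain:

* `finRelHomology_of_interior_cover` — **if `interior U ∪ interior V = X` and `H_•(U)`,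
  `H_•(V)`, `H_•(U ∩ V)` are finitely generated and vanish from degree `N` on, then `H_•(X)` is
  finitely generated, vanishes from degree `N + 1` on, and `χ(X) + χ(U ∩ V) = χ(U) + χ(V)`**
  (all Euler characteristics are the tree's `relEuler R M · ∅`);
* `finRelHomology_union_of_isOpen` — the same for two open subsets `A`, `B` of any space, about
  the subspaces `A ∪ B`, `A`, `B`, `A ∩ B` (the cover of `A ∪ B` by the traces of `A` and `B`,
  `SphereComplement.interior_union_interior_eq_univ`,
  `SphereComplement.preimageValHomeomorphOfSubset`).

Everything is proved; there are no definitions and no named facts.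

## References

* A. Hatcher, *Algebraic Topology*, CUP 2002, §2.2 pp. 149–150 (Mayer–Vietoris), Thm. 2.44 and its
  proof, Exercises 2.2.20–21. [HatcherAT2002]
* E. H. Spanier, *Algebraic Topology* (1966), Ch. 4 §3 Thm. 14, §6. [Spanier1981]
-/

noncomputable section

open CategoryTheory Limits Set

universe u v

namespace Literature.AlgebraicTopology.SingularHomology

variable (R : Type v) [CommRing R] (M : Type v) [AddCommGroup M] [Module R M]
variable {X : Type u} [TopologicalSpace X]

/-! ### Additivity of finiteness and of the Euler characteristic along Mayer–Vietoris -/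

/-- **`rank (P × Q) = rank P + rank Q`** for finitely generated modules over a ring satisfying
rank–nullity (no freeness needed: rank–nullity for the projection `P × Q → P`, whose kernel is
`Q`). [folklore] -/
theorem finrank_prod_of_hasRankNullity [HasRankNullity.{max u v} R] (P Q : Type (max u v))
    [AddCommGroup P] [Module R P] [AddCommGroup Q] [Module R Q] [Module.Finite R P]
    [Module.Finite R Q] :
    Module.finrank R (P × Q) = Module.finrank R P + Module.finrank R Q := by
  haveI : Nontrivial R := nontrivial_of_hasRankNullity.{max u v} R
  have h := Submodule.finrank_quotient_add_finrank (LinearMap.ker (LinearMap.fst R P Q))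
  rw [LinearEquiv.finrank_eq
      ((LinearMap.fst R P Q).quotKerEquivOfSurjective LinearMap.fst_surjective),
    LinearMap.ker_fst, ← LinearEquiv.finrank_eq
      (LinearEquiv.ofInjective (LinearMap.inr R P Q) LinearMap.inr_injective)] at h
  exact h.symm

/-- `rank (P ⊞ Q) = rank P + rank Q` for finitely generated modules in `ModuleCat`. [folklore] -/
theorem finrank_biprod [HasRankNullity.{max u v} R] (P Q : ModuleCat.{max u v} R)
    [Module.Finite R P] [Module.Finite R Q] :
    Module.finrank R ↑(P ⊞ Q) = Module.finrank R P + Module.finrank R Q := by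
  rw [(ModuleCat.biprodIsoProd P Q).toLinearEquiv.finrank_eq]
  exact finrank_prod_of_hasRankNullity R P Q

/-- `P ⊞ Q` is finitely generated if `P` and `Q` are. [folklore] -/
theorem finite_biprod (P Q : ModuleCat.{max u v} R) [Module.Finite R P] [Module.Finite R Q] :
    Module.Finite R ↑(P ⊞ Q) :=
  haveI : Module.Finite R ↑(ModuleCat.of R (↑P × ↑Q)) := inferInstanceAs (Module.Finite R (↑P × ↑Q))
  Module.Finite.equiv (ModuleCat.biprodIsoProd P Q).toLinearEquiv.symm

variable [IsNoetherianRing R] [HasRankNullity.{max u v} R]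

/-- **The Euler characteristic along the Mayer–Vietoris sequence.**  Let `U, V ⊆ X` have interiors
covering `X`, and suppose the homology (coefficients `M`) of `U`, `V` and `U ∩ V` is finitely
generated and vanishes from degree `N` on.  Then the homology of `X` is finitely generated,
vanishes from degree `N + 1` on, and `χ(X) + χ(U ∩ V) = χ(U) + χ(V)` (Hatcher 2002, §2.2,
pp. 149–150 with the proof of Thm. 2.44: rank–nullity along the long exact sequence, the tree's
`GradedLES.eulerSum_rel`). [cite: HatcherAT2002, §2.2 pp. 149–150 and Thm. 2.44 (proof)] -/
theorem finRelHomology_of_interior_cover {U V : Set X} (hcov : interior U ∪ interior V = univ)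
    {N : ℕ} (hU : FinRelHomology R M (↥U) ∅ N) (hV : FinRelHomology R M (↥V) ∅ N)
    (hUV : FinRelHomology R M (↥(U ∩ V)) ∅ N) :
    FinRelHomology R M X ∅ (N + 1) ∧
      relEuler R M X ∅ + relEuler R M (↥(U ∩ V)) ∅ = relEuler R M (↥U) ∅ + relEuler R M (↥V) ∅ := by
  haveI : Nontrivial R := nontrivial_of_hasRankNullity.{max u v} R
  have hexc := relativeSingularHomology.isIso_map_of_interior_union_interior_holds R M (X := X)
  -- the Mayer–Vietoris sequence as a long exact sequence of graded modules
  let L : GradedLES.{v, max u v} R :=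
    { A := fun k => singularHomology R M (↥(U ∩ V)) k
      B := fun k => singularHomology R M (↥U) k ⊞ singularHomology R M (↥V) k
      C := fun k => singularHomology R M X k
      i := fun k => mayerVietoris.φ R M U V k
      j := fun k => mayerVietoris.ψ R M U V k
      d := fun k => mayerVietoris.δ R M U V hexc hcov k
      d_i := fun k => mayerVietoris.δ_comp_φ R M U V hexc hcov k
      i_j := fun k => mayerVietoris.φ_comp_ψ R M U V k
      j_d := fun k => mayerVietoris.ψ_comp_δ R M U V hexc hcov k
      exact₁ := fun k => mayerVietoris.exact₃_holds R M U V hexc hcov k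
      exact₂ := fun k => mayerVietoris.exact₁_holds R M U V hcov k
      exact₃ := fun k => mayerVietoris.exact₂_holds R M U V hexc hcov k
      epi_j_zero := (ModuleCat.epi_iff_surjective _).2
        (mayerVietoris.ψ_surjective_zero R M U V hexc hcov) }
  -- finiteness of the three rows
  have hA : ∀ k, Module.Finite R (L.A k) := fun k => hUV.finite_singularHomology k
  have hB : ∀ k, Module.Finite R (L.B k) := fun k => by
    haveI := hU.finite_singularHomology k
    haveI := hV.finite_singularHomology k
    exact finite_biprod R _ _
  have hC : ∀ k, Module.Finite R (L.C k) := fun k => by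
    cases k with
    | zero => exact L.finite_C_zero (hB 0)
    | succ k => exact L.finite_C_succ k (hB (k + 1)) (hA k)
  -- vanishing
  have hA0 : ∀ k, N ≤ k → IsZero (L.A k) := fun k hk => hUV.isZero_singularHomology k hk
  have hB0 : ∀ k, N ≤ k → IsZero (L.B k) := fun k hk =>
    (hV.isZero_singularHomology k hk).of_iso (isoZeroBiprod (hU.isZero_singularHomology k hk)).symm
  have hC0 : ∀ k, N + 1 ≤ k → IsZero (L.C k) := fun k hk => by
    cases k with
    | zero => omega
    | succ k => exact L.isZero_C_succ k (hB0 (k + 1) (by omega)) (hA0 k (by omega))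
  have hX : FinRelHomology R M X ∅ (N + 1) := FinRelHomology.empty_of_absolute hC hC0
  refine ⟨hX, ?_⟩
  -- the Euler characteristics as truncated sums
  have key := L.eulerSum_rel (N + 1) (fun k _ => hA k) (fun k _ => hB k) (fun k _ => hC k)
    (hC0 (N + 1) le_rfl)
  have eA : relEuler R M (↥(U ∩ V)) ∅ = eulerSum R L.A (N + 1) :=
    ((hUV.mono (Nat.le_succ N)).relEuler_eq_eulerSum).trans
      (eulerSum_congr fun k _ => (relativeSingularHomology.emptyIso R M _ k).symm)
  have eC : relEuler R M X ∅ = eulerSum R L.C (N + 1) :=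
    (hX.relEuler_eq_eulerSum).trans
      (eulerSum_congr fun k _ => (relativeSingularHomology.emptyIso R M _ k).symm)
  have eU : relEuler R M (↥U) ∅ = eulerSum R (fun k => singularHomology R M (↥U) k) (N + 1) :=
    ((hU.mono (Nat.le_succ N)).relEuler_eq_eulerSum).trans
      (eulerSum_congr fun k _ => (relativeSingularHomology.emptyIso R M _ k).symm)
  have eV : relEuler R M (↥V) ∅ = eulerSum R (fun k => singularHomology R M (↥V) k) (N + 1) :=
    ((hV.mono (Nat.le_succ N)).relEuler_eq_eulerSum).trans
      (eulerSum_congr fun k _ => (relativeSingularHomology.emptyIso R M _ k).symm)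
  have eB : eulerSum R L.B (N + 1) =
      eulerSum R (fun k => singularHomology R M (↥U) k) (N + 1) +
        eulerSum R (fun k => singularHomology R M (↥V) k) (N + 1) := by
    simp only [eulerSum, ← Finset.sum_add_distrib, ← mul_add]
    refine Finset.sum_congr rfl fun k _ => ?_
    haveI := hU.finite_singularHomology k
    haveI := hV.finite_singularHomology k
    rw [show L.B k = (singularHomology R M (↥U) k ⊞ singularHomology R M (↥V) k) from rfl,
      finrank_biprod R]
    push_cast
    ring
  rw [eA, eC, eU, eV, ← eB]
  linarith

/-- **Mayer–Vietoris for two open subsets**: for open `A, B ⊆ X` whose homology and that of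
`A ∩ B` (coefficients `M`) is finitely generated and vanishes from degree `N` on, the homology of
`A ∪ B` is finitely generated, vanishes from degree `N + 1` on, and
`χ(A ∪ B) + χ(A ∩ B) = χ(A) + χ(B)` (Hatcher 2002, §2.2 pp. 149–150, Ex. 2.2.20).
[cite: HatcherAT2002, §2.2 pp. 149–150 and Thm. 2.44 (proof)] -/
theorem finRelHomology_union_of_isOpen {A B : Set X} (hA : IsOpen A) (hB : IsOpen B) {N : ℕ}
    (hfA : FinRelHomology R M (↥A) ∅ N) (hfB : FinRelHomology R M (↥B) ∅ N)
    (hfAB : FinRelHomology R M (↥(A ∩ B)) ∅ N) :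
    FinRelHomology R M (↥(A ∪ B)) ∅ (N + 1) ∧
      relEuler R M (↥(A ∪ B)) ∅ + relEuler R M (↥(A ∩ B)) ∅ =
        relEuler R M (↥A) ∅ + relEuler R M (↥B) ∅ := by
  have hcov := SphereComplement.interior_union_interior_eq_univ hA hB
  -- the traces of `A`, `B`, `A ∩ B` on `A ∪ B`
  let eA : ↥(Subtype.val ⁻¹' A : Set ↥(A ∪ B)) ≃ₜ ↥A :=
    SphereComplement.preimageValHomeomorphOfSubset subset_union_left
  let eB : ↥(Subtype.val ⁻¹' B : Set ↥(A ∪ B)) ≃ₜ ↥B :=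
    SphereComplement.preimageValHomeomorphOfSubset subset_union_right
  let eAB : ↥((Subtype.val ⁻¹' A : Set ↥(A ∪ B)) ∩ Subtype.val ⁻¹' B) ≃ₜ ↥(A ∩ B) :=
    SphereComplement.preimageValHomeomorphOfSubset (inter_subset_left.trans subset_union_left)
  have hU : FinRelHomology R M ↥(Subtype.val ⁻¹' A : Set ↥(A ∪ B)) ∅ N :=
    (hfA.of_homeomorph eA.symm (mapsTo_empty _ _) (mapsTo_empty _ _))
  have hV : FinRelHomology R M ↥(Subtype.val ⁻¹' B : Set ↥(A ∪ B)) ∅ N :=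
    (hfB.of_homeomorph eB.symm (mapsTo_empty _ _) (mapsTo_empty _ _))
  have hUV : FinRelHomology R M ↥((Subtype.val ⁻¹' A : Set ↥(A ∪ B)) ∩ Subtype.val ⁻¹' B) ∅ N :=
    (hfAB.of_homeomorph eAB.symm (mapsTo_empty _ _) (mapsTo_empty _ _))
  obtain ⟨h, hχ⟩ := finRelHomology_of_interior_cover R M hcov hU hV hUV
  refine ⟨h, ?_⟩
  rw [relEuler_eq_of_homeomorph (R := R) (M := M) eAB (mapsTo_empty _ _) (mapsTo_empty _ _),
    relEuler_eq_of_homeomorph (R := R) (M := M) eA (mapsTo_empty _ _) (mapsTo_empty _ _),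
    relEuler_eq_of_homeomorph (R := R) (M := M) eB (mapsTo_empty _ _) (mapsTo_empty _ _)] at hχ
  exact hχ

end Literature.AlgebraicTopology.SingularHomology
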